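import Mathlib
import HarnessLib

/-!
# Monomial bases modulo units of a valuation ring

Topic `RingTheory/Valuation` (placed under `RepresentationTheory/AlgebraicGroups` next to its
consumer); theorems only. Let `O` be a valuation subring of a field `L` and `e₁, …, e_m ∈ L^×`.
The subgroup of the value group generated by the values `v(e_i)` is finitely generated and
torsion free, hence free abelian; lifting a basis to `L^×` gives:

* `ValuationSubring.exists_monomial_basis` — there are `π₁, …, π_r ∈ L^×`, integer exponents
  `n_{ij}` and UNITS `ε_i ∈ O^×` with `e_i = (∏_j π_j^{n_{ij}}) · ε_i`, the `π_j` being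
  valuation-independent: a monomial `∏_j π_j^{k_j}` is a unit of `O` only if `k = 0`.

This is the bookkeeping device replacing the uniformiser `t` of a discrete valuation (where
`π = (t)` and `e_i = t^{n_i} ε_i`) for a general valuation, in the valuative proof of the
Hilbert–Mumford criterion (item `HilbertMumfordHalf`, route MatrixMultiplication/ToricBorderRank):
the diagonal part of a Cartan decomposition `γ = P · diag(e) · Q` is renormalised to MONOMIALS in
the `π_j`, so that a product of diagonal entries of valuation zero is literally `1`.

## References

Folklore (structure of finitely generated subgroups of the value group `L^×/O^×`, which is a
torsion-free abelian group since `O` is integrally closed).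
-/

namespace Literature.RepresentationTheory.AlgebraicGroups

variable {L : Type*} [Field L] (O : ValuationSubring L)

/-- The class group `L^× / O^×` of a valuation subring is torsion free: `x^k ∈ O^×` with `k ≠ 0`
forces `x ∈ O^×` (its valuation `a` satisfies `a^k = 1` in the linearly ordered value group).
[folklore] -/
theorem _root_.ValuationSubring.valuation_eq_one_of_zpow {x : L} (hx : x ≠ 0) {k : ℤ} (hk : k ≠ 0)
    (h : O.valuation (x ^ k) = 1) : O.valuation x = 1 := by
  rw [map_zpow₀] at h
  have hx' : 0 < O.valuation x := zero_lt_iff.mpr ((Valuation.ne_zero_iff _).mpr hx)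
  rcases lt_trichotomy (O.valuation x) 1 with hlt | heq | hgt
  · exfalso
    rcases lt_or_gt_of_ne hk with hk' | hk'
    · have := one_lt_zpow_of_neg₀ hx' hlt hk'
      rw [h] at this
      exact lt_irrefl _ this
    · have := zpow_lt_one₀ hx' hlt hk'
      rw [h] at this
      exact lt_irrefl _ this
  · exact heq
  · exfalso
    rcases lt_or_gt_of_ne hk with hk' | hk'
    · have := zpow_lt_one_of_neg₀ hgt hk'
      rw [h] at this
      exact lt_irrefl _ this
    · have := one_lt_zpow₀ hgt hk'
      rw [h] at this
      exact lt_irrefl _ this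

/-- Units of `O` are the nonzero elements of valuation `1`: for `x ≠ 0`,
`x ∈ O ∧ x⁻¹ ∈ O ↔ v x = 1`. [folklore] -/
theorem _root_.ValuationSubring.mem_and_inv_mem_iff {x : L} (hx : x ≠ 0) :
    x ∈ O ∧ x⁻¹ ∈ O ↔ O.valuation x = 1 := by
  rw [← O.valuation_le_one_iff, ← O.valuation_le_one_iff, map_inv₀]
  have hx' : 0 < O.valuation x := zero_lt_iff.mpr ((Valuation.ne_zero_iff _).mpr hx)
  rw [inv_le_one₀ hx']
  constructor
  · rintro ⟨h1, h2⟩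
    exact le_antisymm h1 h2
  · intro h
    rw [h]
    exact ⟨le_rfl, le_rfl⟩

/-- **Monomial basis modulo units of a valuation ring.** For finitely many nonzero `e_i ∈ L` there
are nonzero `π₁, …, π_r`, integer exponents `n_{ij}` and units `ε_i` of `O` with
`e_i = (∏_j π_j ^ n_{ij}) · ε_i`, such that a monomial `∏_j π_j ^ k_j` is a unit of `O` only for
`k = 0` (lift a basis of the free abelian group generated by the classes of the `e_i` in
`L^×/O^×`). [folklore] -/
theorem _root_.ValuationSubring.exists_monomial_basis {m : Type*} [Fintype m] (e : m → L)
    (he : ∀ i, e i ≠ 0) :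
    ∃ (r : ℕ) (π : Fin r → L) (n : m → Fin r → ℤ) (ε : m → L),
      (∀ j, π j ≠ 0) ∧ (∀ i, ε i ∈ O ∧ (ε i)⁻¹ ∈ O) ∧ (∀ i, e i = (∏ j, π j ^ n i j) * ε i) ∧
      (∀ k : Fin r → ℤ, (∏ j, π j ^ k j) ∈ O → (∏ j, π j ^ k j)⁻¹ ∈ O → k = 0) := by
  classical
  -- the class group `L^× / O^×`, written additively: `M = Additive L^× ⧸ N`, a torsion-free `ℤ`-module
  set N : AddSubgroup (Additive Lˣ) := Subgroup.toAddSubgroup O.unitGroup with hN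
  have hmemN : ∀ u : Lˣ, Additive.ofMul u ∈ N ↔ O.valuation (u : L) = 1 := fun u => by
    rw [hN, Additive.mem_toAddSubgroup, toMul_ofMul, ValuationSubring.mem_unitGroup_iff]
  haveI : Module.IsTorsionFree ℤ (Additive Lˣ ⧸ N) := by
    refine Module.IsTorsionFree.of_smul_eq_zero fun k x hkx => ?_
    by_cases hk : k = 0
    · exact Or.inl hk
    right
    induction x using QuotientAddGroup.induction_on with
    | H a =>
      -- `k • [a] = 0` means `(toMul a) ^ k ∈ O^×`
      have h1 : ((k • a : Additive Lˣ) : Additive Lˣ ⧸ N) = 0 := by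
        rw [QuotientAddGroup.mk_zsmul]
        exact hkx
      rw [QuotientAddGroup.eq_zero_iff, show k • a = Additive.ofMul ((Additive.toMul a) ^ k) by
        rw [ofMul_zpow]; rfl, hmemN, Units.val_zpow_eq_zpow_val] at h1
      have h2 := O.valuation_eq_one_of_zpow (Units.ne_zero _) hk h1
      rw [QuotientAddGroup.eq_zero_iff, show a = Additive.ofMul (Additive.toMul a) from rfl, hmemN]
      exact h2
  -- the submodule generated by the classes of the `e_i`: finite and torsion free, hence free
  set cls : m → Additive Lˣ ⧸ N := fun i =>
    ((Additive.ofMul (Units.mk0 (e i) (he i)) : Additive Lˣ) : Additive Lˣ ⧸ N) with hcls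
  set H : Submodule ℤ (Additive Lˣ ⧸ N) := Submodule.span ℤ (Set.range cls) with hH
  haveI : Module.Finite ℤ H := Module.Finite.span_of_finite ℤ (Set.finite_range cls)
  obtain ⟨r, b⟩ := Module.basisOfFiniteTypeTorsionFree' (R := ℤ) (M := H)
  -- lift the basis to `L^×`
  have hlift : ∀ j : Fin r, ∃ u : Lˣ,
      ((Additive.ofMul u : Additive Lˣ) : Additive Lˣ ⧸ N) = ((b j : H) : Additive Lˣ ⧸ N) :=
    fun j => by
      obtain ⟨a, ha⟩ := QuotientAddGroup.mk_surjective ((b j : H) : Additive Lˣ ⧸ N)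
      exact ⟨Additive.toMul a, ha⟩
  choose πu hπu using hlift
  -- coordinates of the `e_i`
  have hmem : ∀ i, cls i ∈ H := fun i => Submodule.subset_span ⟨i, rfl⟩
  set n : m → Fin r → ℤ := fun i j => b.repr ⟨cls i, hmem i⟩ j with hn
  -- monomials
  have hmono : ∀ k : Fin r → ℤ,
      ((Additive.ofMul (∏ j, πu j ^ k j) : Additive Lˣ) : Additive Lˣ ⧸ N) =
        ((∑ j, k j • b j : H) : Additive Lˣ ⧸ N) := by
    intro k
    rw [ofMul_prod, QuotientAddGroup.mk_sum, Submodule.coe_sum]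
    refine Finset.sum_congr rfl fun j _ => ?_
    rw [ofMul_zpow, QuotientAddGroup.mk_zsmul, hπu, Submodule.coe_smul]
  have hprodval : ∀ k : Fin r → ℤ, ((∏ j, πu j ^ k j : Lˣ) : L) = ∏ j, (πu j : L) ^ k j := by
    intro k
    push_cast [Units.val_zpow_eq_zpow_val]
    rfl
  refine ⟨r, fun j => (πu j : L), n, fun i => e i * (∏ j, (πu j : L) ^ n i j)⁻¹,
    fun j => (πu j).ne_zero, fun i => ?_, fun i => ?_, fun k hk hk' => ?_⟩
  · -- `ε_i` is a unit: its class is `[e_i] - Σ n_ij b_j = 0`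
    have hprod : (∏ j, (πu j : L) ^ n i j) ≠ 0 :=
      Finset.prod_ne_zero_iff.mpr fun j _ => zpow_ne_zero _ (πu j).ne_zero
    rw [ValuationSubring.mem_and_inv_mem_iff O (mul_ne_zero (he i) (inv_ne_zero hprod))]
    have hrepr : (⟨cls i, hmem i⟩ : H) = ∑ j, n i j • b j := by
      conv_lhs => rw [← b.sum_repr ⟨cls i, hmem i⟩]
    have h1 : ((Additive.ofMul (∏ j, πu j ^ n i j) : Additive Lˣ) : Additive Lˣ ⧸ N) = cls i := by
      rw [hmono, ← hrepr]
    rw [hcls, QuotientAddGroup.eq, ← ofMul_inv, ← ofMul_mul, hmemN] at h1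
    -- `v ((∏ π^n)⁻¹ * e_i) = 1`
    rw [mul_comm]
    convert h1 using 2
    rw [Units.val_mul, Units.val_inv_eq_inv_val, hprodval]
    rfl
  · have hprod : (∏ j, (πu j : L) ^ n i j) ≠ 0 :=
      Finset.prod_ne_zero_iff.mpr fun j _ => zpow_ne_zero _ (πu j).ne_zero
    show e i = (∏ j, (πu j : L) ^ n i j) * (e i * (∏ j, (πu j : L) ^ n i j)⁻¹)
    rw [mul_left_comm, mul_inv_cancel₀ hprod, mul_one]
  · -- independence: `Σ k_j b_j = 0` in `H`
    have hprod : (∏ j, (πu j : L) ^ k j) ≠ 0 :=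
      Finset.prod_ne_zero_iff.mpr fun j _ => zpow_ne_zero _ (πu j).ne_zero
    have hv : O.valuation (∏ j, (πu j : L) ^ k j) = 1 := (O.mem_and_inv_mem_iff hprod).mp ⟨hk, hk'⟩
    have h1 : ((Additive.ofMul (∏ j, πu j ^ k j) : Additive Lˣ) : Additive Lˣ ⧸ N) = 0 := by
      rw [QuotientAddGroup.eq_zero_iff, hmemN, hprodval]
      exact hv
    have h2 : ((∑ j, k j • b j : H) : Additive Lˣ ⧸ N) = 0 := by rw [← hmono, h1]
    have h3 : (∑ j, k j • b j : H) = 0 := Subtype.ext h2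
    funext j
    have := b.linearIndependent
    rw [Fintype.linearIndependent_iff] at this
    exact this k h3 j

end Literature.RepresentationTheory.AlgebraicGroups
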